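import Mathlib
import Summits.AtomisticToContinuum.HydrodynamicLimit.Theses.ImplosionDichotomy
import Summits.AtomisticToContinuum.HydrodynamicLimit.Theorems.ImplosionDichotomyDenseExcursionR2Package

/-!
# Sketch — crux-ideate stmt-AtomisticToContinuum-12586 (`DenseExcursion`), round 2, ideator 4

First-lemma signatures for the crux idea card `r6-depth-one-tuning` (depth-for-width trade: at the
sixth smooth monatomic profile `SS(r₆)`, `r₆ = 1.19008839…`, every Melnikov tuning condition of the
forced real-gas tracking problem is FIRST ORDER in `σ³`, because all genuine unstable smooth radial rates
lie below `2μ = 6(r₆ - 1)`; numerics of three seats: `0.384 | 0.572, 0.755, 0.931, 1.090` against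
`μ = 3(r₆-1) = 0.57027`, ratios `0.673 | 1.003, 1.325, 1.633, 1.9115`).

* `PolynomialCompressionAt κ` (restated from ideator 2's sketch) and the NEW untuned rung
  `UntunedCompressionR6 := PolynomialCompressionAt (3/2)` — strictly stronger than the `r₂` rung
  `PolynomialCompressionAt 1` and than the `r₄` prediction `κ* = 1.482`; it tests the `r₆` rates
  (`κ*(r₆) = 3μ/λ_top = 3·0.57027/1.09007 = 1.5694 > 3/2`).
* `DepthOnePackage r W S` — the certified-numerics package of the line, over the LANDED vocabulary of
  `Theorems/…R2Modes.lean` / `…R2Package.lean` (`IsMonatomicProfile`, `IsSmoothRadialMode`,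
  `IsGeneralizedMode`): every smooth radial mode with `Re Λ > 0` other than the gauge `Λ = r` is REAL,
  lies strictly below `6(r-1) = 2μ`, is not exactly at `μ`, and the modes in `(μ, 2μ)` are algebraically
  simple and finitely many.
* `SixthProfileDepthOne` — existence of a profile in the `r₆` window `(1.19, 1.1902)` with the package
  (the analogue of the r2 line's `stub_profilePackage`).
* `denseExcursion_of_depthOne_of_tuning` — bookkeeping: the crux follows from the package plus
  "depth-one tuned packing" (`TunedPacking` is literally the flow-free crux, `tunedPacking_iff_denseExcursion`).
-/

namespace Summit.AtomisticToContinuum.HydrodynamicLimit.Cruxes.DenseExcursion.IdeatorFourSketch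

open Literature.MathematicalPhysics.KineticTheory
open Summit.AtomisticToContinuum.HydrodynamicLimit.Theses.ImplosionDichotomy
open Summit.AtomisticToContinuum.HydrodynamicLimit.Theorems.R2OneModeTwoConditions

/-- Admissibility of a classical hard-sphere-Euler solution for profiles `(a₀,u₀,θ₀)` at reduced
diameter `σ` (the `t = 0` LLN tie of `DenseExcursion`, verbatim). -/
def Admissible (σ : ℝ) (a₀ θ₀ : T3 → ℝ) (u₀ : T3 → V3) (T : ℝ) (ρ θ : ℝ → T3 → ℝ)
    (u : ℝ → T3 → V3) : Prop :=
  IsHardSphereEulerSolution σ T ρ u θ ∧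
    ∀ Φ : (N : ℕ) → Literature.Analysis.FluidPDE.HardSphereFlow
        (Literature.Analysis.FluidPDE.Torus.geometry (Fin 3)) (hsDiameter σ N) (N + 1),
      TendstoHydroFieldsAt (fun N => localGibbsLaw σ a₀ u₀ θ₀ N (Φ N)) Φ ρ u θ 0

/-- `PolynomialCompression` of the route with the exponent made explicit (restated from ideator 2's
sketch so that the rung below is self-contained). -/
def PolynomialCompressionAt (κ : ℝ) : Prop :=
  ∃ (a₀ θ₀ : T3 → ℝ) (u₀ : T3 → V3), Continuous a₀ ∧ Continuous θ₀ ∧ Continuous u₀ ∧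
    (∀ x, 0 < a₀ x) ∧ (∀ x, 0 < θ₀ x) ∧
    ∀ σ₀ : ℝ, 0 < σ₀ → ∃ σ : ℝ, 0 < σ ∧ σ < σ₀ ∧
      ∃ (T : ℝ) (ρ θ : ℝ → T3 → ℝ) (u : ℝ → T3 → V3), Admissible σ a₀ θ₀ u₀ T ρ θ u ∧
        ∃ t ∈ Set.Ico 0 T, ∃ x, σ ^ (-κ) ≤ ρ t x

/-- FIRST LEMMA (a): the UNTUNED RUNG AT `SS(r₆)`. Modulation-only (no Melnikov condition) forced
stability of the sixth smooth spherical γ = 5/3 profile under the O(packing) hard-sphere forcing exits at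
packing `∝ σ^{3(1 - μ/λ_top)} = σ^{1.43}`, i.e. density `σ^{-κ}` for every `κ < κ*(r₆) = 3μ/λ_top = 1.5694`
(`μ = 0.57027`, `λ_top = 1.09007`). Stated at `κ = 3/2` — above the `r₂` (`1.274`) and `r₄` (`1.482`)
thresholds, so it is a genuine test of the `r₆` spectrum. -/
def UntunedCompressionR6 : Prop := PolynomialCompressionAt (3 / 2)

/-- The route's `PolynomialCompression` follows from any fixed positive exponent. -/
theorem polynomialCompression_of_at {κ : ℝ} (hκ : 0 < κ) (h : PolynomialCompressionAt κ) :
    PolynomialCompression := by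
  obtain ⟨a₀, θ₀, u₀, ha, hθ, hu, ha0, hθ0, H⟩ := h
  refine ⟨κ, hκ, a₀, θ₀, u₀, ha, hθ, hu, ha0, hθ0, ?_⟩
  intro σ₀ hσ₀
  obtain ⟨σ, hσ, hσlt, T, ρ, θ, u, ⟨hE, hΦ⟩, t, ht, x, hx⟩ := H σ₀ hσ₀
  exact ⟨σ, hσ, hσlt, T, ρ, θ, u, hE, hΦ, t, ht, x, hx⟩

/-- In particular the `r₆` rung implies the (closed) rank-4 crux. -/
theorem polynomialCompression_of_untunedR6 (h : UntunedCompressionR6) : PolynomialCompression :=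
  polynomialCompression_of_at (by norm_num) h

/-- THE DEPTH-ONE PACKAGE of the line `r6-depth-one-tuning`: a globally smooth monatomic profile `(r, W, S)`
(landed notion `IsMonatomicProfile`) whose smooth radial point spectrum in `Re Λ > 0` consists of the gauge
`Λ = r` and of REAL modes strictly below `2μ = 6(r-1)` and different from `μ = 3(r-1)`, the ones in
`(μ, 2μ)` being algebraically simple (no `IsGeneralizedMode` over them) and finitely many. Consequence for
the forced σ-problem (packing clock `μ`, forcing and data defect both power series in `σ³`): a mode `λ`
with `λ < μ` is slaved, and a mode with `μ < λ < 2μ` needs exactly ONE tuning condition, of order `σ³`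
(the `σ⁶`-seed `σ⁶ (η/σ³)^{λ/μ} → 0`): EVERY condition is first order. At `r₆ ≈ 1.19009`:
`μ = 0.57027`, modes `0.384 < μ < 0.572, 0.755, 0.931, 1.090 < 2μ = 1.1405` (three seats' codes). -/
def DepthOnePackage (r : ℝ) (W S : ℝ → ℝ) : Prop :=
  IsMonatomicProfile r W S ∧
  (∀ Λ : ℂ, 0 < Λ.re → (∃ ŵ ŝ : ℝ → ℂ, IsSmoothRadialMode r W S Λ ŵ ŝ) →
      Λ = (r : ℂ) ∨ (Λ.im = 0 ∧ Λ.re < 6 * (r - 1) ∧ Λ.re ≠ 3 * (r - 1))) ∧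
  (∀ Λ : ℝ, 3 * (r - 1) < Λ → Λ < 6 * (r - 1) →
      ∀ ŵ₁ ŝ₁ : ℝ → ℂ, IsSmoothRadialMode r W S (Λ : ℂ) ŵ₁ ŝ₁ →
        ∀ ŵ₂ ŝ₂ : ℝ → ℂ, ¬ IsGeneralizedMode r W S (Λ : ℂ) ŵ₁ ŝ₁ ŵ₂ ŝ₂) ∧
  Set.Finite {Λ : ℝ | 3 * (r - 1) < Λ ∧ Λ < 6 * (r - 1) ∧
      ∃ ŵ ŝ : ℝ → ℂ, IsSmoothRadialMode r W S (Λ : ℂ) ŵ ŝ}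

/-- FIRST LEMMA (b) (certified-numerics statement, the analogue of the r2 line's `stub_profilePackage`):
there is a globally smooth monatomic profile in the `r₆` window `1.19 < r < 1.1902` — with its two
profile equations in original (solved) form — carrying the depth-one package. Numerically
`r₆ = 1.1900883882` (this seat, 8th profile code; triage r1-3: `1.1900884`). -/
def SixthProfileDepthOne : Prop :=
  ∃ (r : ℝ) (W S : ℝ → ℝ), (119 / 100 < r ∧ r < 5951 / 5000) ∧
    (∀ x, (W x - 1) * deriv W x + 3 * S x * deriv S x = r * W x - W x ^ 2 - 3 * S x ^ 2 ∧
      (1 - W x) * deriv S x - S x / 3 * deriv W x = S x * (2 * W x - r)) ∧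
    DepthOnePackage r W S

/-- A profile with the depth-one package is in particular a globally smooth monatomic profile with
`r > 1`, so both thresholds `3(r-1)` and `6(r-1)` are positive. -/
theorem DepthOnePackage.thresholds_pos {r : ℝ} {W S : ℝ → ℝ} (h : DepthOnePackage r W S) :
    0 < 3 * (r - 1) ∧ 0 < 6 * (r - 1) := by
  have hr : 1 < r := h.1.1
  constructor <;> linarith

/-- The gauge mode is not among the genuine first-order modes: `r ∉ (3(r-1), 6(r-1))` needs `r < 6/5`,
which holds in the `r₆` window (`r < 1.1902`). -/
theorem gauge_above_window {r : ℝ} (hr : r < 5951 / 5000) : 6 * (r - 1) < r := by linarith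

/-- BOOKKEEPING — the reduction of the crux to the two open statements of the line `r6-depth-one-tuning`:
`DenseExcursion` follows from (i) the depth-one package at a profile in the `r₆` window
(`SixthProfileDepthOne`, certified numerics) and (ii) DEPTH-ONE TUNED PACKING: such a profile forces
`TunedPacking` (the heart: first-order forced modulation stability with `J` first-order Melnikov conditions met
on knob × entropy-bump directions). `TunedPacking ↔ DenseExcursion` is landed (`tunedPacking_iff_denseExcursion`). -/
theorem denseExcursion_of_depthOne_of_tuning
    (hpkg : SixthProfileDepthOne)
    (htune : ∀ (r : ℝ) (W S : ℝ → ℝ), 119 / 100 < r → r < 5951 / 5000 →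
      (∀ x, (W x - 1) * deriv W x + 3 * S x * deriv S x = r * W x - W x ^ 2 - 3 * S x ^ 2 ∧
        (1 - W x) * deriv S x - S x / 3 * deriv W x = S x * (2 * W x - r)) →
      DepthOnePackage r W S → TunedPacking) :
    DenseExcursion := by
  obtain ⟨r, W, S, ⟨hr₁, hr₂⟩, heqs, hP⟩ := hpkg
  exact tunedPacking_iff_denseExcursion.mp (htune r W S hr₁ hr₂ heqs hP)

end Summit.AtomisticToContinuum.HydrodynamicLimit.Cruxes.DenseExcursion.IdeatorFourSketch
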